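import Summits.KontsevichZagierPeriods.Zeta5Search.TwoTaleLineBoundRC
import Literature.NumberTheory.Irrationality.Zudilin2014.SecondTaleComplex

/-!
# Line-bound blocks for a general SECOND-tale point: `log ‖R̂(â,b̂; u+iy)‖` in closed form

HONEST FRAMING: systematic search; no irrationality claim unless certified.

Cell pub-zeta5, T3 service (P1 g10) for fam-measure's U2 chain (`DecayT`): the second-tale twin of
`TwoTaleLineBoundRC` (P1 g9).  For `a b : Fin 4 → ℤ` and the Literature's complex `Zudilin2014.RCT a b s =
numT(s)/denT(s)`, at `s = u + iy`, `y ≠ 0`: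
* **`log_norm_RCT_eq`** — `log ‖R̂(u+iy)‖ = log|Π̂| + Σ_{ℓ∈[b̂₀,â₀)} halfLog (2y) (2u+ℓ) + Σ_{i∈[b̂₁,â₁)} halfLog y (u+i)
  − Σ_{i∈[â₂,b̂₂)} halfLog y (u+i) − Σ_{i∈[â₃,b̂₃)} halfLog y (u+i)` — the doubled block `∏(2t+ℓ)` is an ORDINARY
  block for the point `2s = 2u + i·2y` (`log_norm_factor_two`);
* **`log_norm_RCT_le`** — every numerator block replaced by its integral in closed form (`TwoTaleLineBound.prim`) plus
  the two endpoint values plus `1 + log 2`, each denominator block by its integral from one node to the left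
  (`sum_halfLog_le` / `le_sum_halfLog`); hypotheses: numerator blocks of length `≥ 2`, `1 ≤ u + â₂`, `1 ≤ u + â₃`.
The P15 partner instantiates it in `TwoTaleP15SecondLineBoundRate.lean`.
-/

noncomputable section

open Real Finset Complex Polynomial
open Literature.NumberTheory.Irrationality.Zudilin2014

namespace Summit.KontsevichZagierPeriods.Zeta5Search.TwoTaleLineBound

variable {y : ℝ}

/-- `log ‖2(u+iy) + ℓ‖ = halfLog (2y) (2u+ℓ)` for an integer `ℓ` (`y ≠ 0`). -/
theorem log_norm_factor_two (hy : y ≠ 0) (u : ℝ) (l : ℤ) :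
    Real.log ‖2 * ((u : ℂ) + (y : ℂ) * I) + (l : ℂ)‖ = halfLog (2 * y) (2 * u + l) := by
  have h : 2 * ((u : ℂ) + (y : ℂ) * I) + (l : ℂ) = (((2 * u : ℝ) : ℂ) + ((2 * y : ℝ) : ℂ) * I) + (l : ℂ) := by
    push_cast; ring
  rw [h, log_norm_factor_int (mul_ne_zero two_ne_zero hy) (2 * u) l]

/-- The doubled factors are nonzero for `y ≠ 0`. -/
theorem factor_two_ne_zero (hy : y ≠ 0) (u : ℝ) (l : ℤ) : 2 * ((u : ℂ) + (y : ℂ) * I) + (l : ℂ) ≠ 0 := by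
  intro h
  have := congrArg Complex.im h
  simp at this
  exact hy this

/-- `log ‖aeval (u+iy) (block2 lo hi)‖ = Σ_{ℓ ∈ [lo,hi)} halfLog (2y) (2u+ℓ)`. -/
theorem log_norm_aeval_block2 (hy : y ≠ 0) (u : ℝ) (lo hi : ℤ) :
    Real.log ‖aeval ((u : ℂ) + (y : ℂ) * I) (block2 lo hi)‖ = ∑ l ∈ Ico lo hi, halfLog (2 * y) (2 * u + l) := by
  rw [aeval_block2_complex, norm_prod, Real.log_prod]
  · exact sum_congr rfl fun l _ => log_norm_factor_two hy u l
  · intro l _; exact norm_ne_zero_iff.2 (factor_two_ne_zero hy u l)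

/-- `aeval (u+iy) (block2 lo hi) ≠ 0` for `y ≠ 0`. -/
theorem aeval_block2_ne_zero (hy : y ≠ 0) (u : ℝ) (lo hi : ℤ) :
    aeval ((u : ℂ) + (y : ℂ) * I) (block2 lo hi) ≠ 0 := by
  rw [aeval_block2_complex]
  exact prod_ne_zero_iff.2 fun l _ => factor_two_ne_zero hy u l

/-- **`log ‖R̂(â,b̂; u+iy)‖` as block sums** (exact, `y ≠ 0`). -/
theorem log_norm_RCT_eq (hy : y ≠ 0) (a b : Fin 4 → ℤ) (u : ℝ) :
    Real.log ‖RCT a b ((u : ℂ) + (y : ℂ) * I)‖ =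
      Real.log |normT a b| + (∑ l ∈ Ico (b 0) (a 0), halfLog (2 * y) (2 * u + l))
        + (∑ i ∈ Ico (b 1) (a 1), halfLog y (u + i))
        - (∑ i ∈ Ico (a 2) (b 2), halfLog y (u + i)) - (∑ i ∈ Ico (a 3) (b 3), halfLog y (u + i)) := by
  unfold RCT numT denT
  set s : ℂ := (u : ℂ) + (y : ℂ) * I with hs
  have hPi : ‖((normT a b : ℚ) : ℂ)‖ = |(normT a b : ℝ)| := by
    rw [show ((normT a b : ℚ) : ℂ) = ((normT a b : ℝ) : ℂ) by norm_cast, Complex.norm_real, Real.norm_eq_abs]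
  have hPi0 : |(normT a b : ℝ)| ≠ 0 := abs_ne_zero.2 (by exact_mod_cast normT_ne_zero a b)
  have hB := fun lo hi => norm_ne_zero_iff.2 (aeval_block_ne_zero hy u lo hi)
  have hB2 := fun lo hi => norm_ne_zero_iff.2 (aeval_block2_ne_zero hy u lo hi)
  rw [map_mul, map_mul, map_mul, aeval_C, eq_ratCast, norm_div, norm_mul, norm_mul, norm_mul, hPi,
    Real.log_div (mul_ne_zero hPi0 (mul_ne_zero (hB2 _ _) (hB _ _))) (mul_ne_zero (hB _ _) (hB _ _)),
    Real.log_mul hPi0 (mul_ne_zero (hB2 _ _) (hB _ _)), Real.log_mul (hB2 _ _) (hB _ _),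
    Real.log_mul (hB _ _) (hB _ _), log_norm_aeval_block2 hy, log_norm_aeval_block hy, log_norm_aeval_block hy,
    log_norm_aeval_block hy]
  ring

/-- **Closed-form upper bound for `log ‖R̂(â,b̂; u+iy)‖`** (`y ≠ 0`; numerator blocks of length `≥ 2`; the line lies
at least one unit to the right of both pole blocks: `1 ≤ u + â₂`, `1 ≤ u + â₃`). -/
theorem log_norm_RCT_le (hy : y ≠ 0) {a b : Fin 4 → ℤ} (h0 : b 0 + 2 ≤ a 0) (h1 : b 1 + 2 ≤ a 1)
    (h2 : a 2 < b 2) (h3 : a 3 < b 3) {u : ℝ} (hu2 : 1 ≤ u + a 2) (hu3 : 1 ≤ u + a 3) :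
    Real.log ‖RCT a b ((u : ℂ) + (y : ℂ) * I)‖ ≤
      Real.log |normT a b|
      + ((prim (2 * y) (2 * u + (a 0 - 1 : ℤ)) - prim (2 * y) (2 * u + b 0)) + halfLog (2 * y) (2 * u + b 0)
          + halfLog (2 * y) (2 * u + (a 0 - 1 : ℤ)) + (1 + Real.log 2))
      + ((prim y (u + (a 1 - 1 : ℤ)) - prim y (u + b 1)) + halfLog y (u + b 1) + halfLog y (u + (a 1 - 1 : ℤ))
          + (1 + Real.log 2))
      - (prim y (u + (b 2 - 1 : ℤ)) - prim y (u + a 2 - 1))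
      - (prim y (u + (b 3 - 1 : ℤ)) - prim y (u + a 3 - 1)) := by
  have hy2 : 2 * y ≠ 0 := mul_ne_zero two_ne_zero hy
  rw [log_norm_RCT_eq hy a b u, sum_IcoInt_halfLog (2 * y) (2 * u) (by omega : b 0 < a 0),
    sum_IcoInt_halfLog y u (by omega : b 1 < a 1), sum_IcoInt_halfLog y u h2, sum_IcoInt_halfLog y u h3]
  have k0 := sum_halfLog_le hy2 (2 * u + (b 0 : ℝ)) (L := (a 0 - 1 - b 0).toNat) (by omega)
  have k1 := sum_halfLog_le hy (u + (b 1 : ℝ)) (L := (a 1 - 1 - b 1).toNat) (by omega)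
  have k2 := le_sum_halfLog hy (x₀ := u + (a 2 : ℝ)) (by linarith) ((b 2 - 1 - a 2).toNat)
  have k3 := le_sum_halfLog hy (x₀ := u + (a 3 : ℝ)) (by linarith) ((b 3 - 1 - a 3).toNat)
  have e0 : (2 * u + (b 0 : ℝ)) + (((a 0 - 1 - b 0).toNat : ℕ) : ℝ) = 2 * u + ((a 0 - 1 : ℤ) : ℝ) := by
    rw [show (((a 0 - 1 - b 0).toNat : ℕ) : ℝ) = ((a 0 - 1 - b 0 : ℤ) : ℝ) by exact_mod_cast Int.toNat_of_nonneg (by omega)]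
    push_cast; ring
  have e1 : (u + (b 1 : ℝ)) + (((a 1 - 1 - b 1).toNat : ℕ) : ℝ) = u + ((a 1 - 1 : ℤ) : ℝ) := by
    rw [show (((a 1 - 1 - b 1).toNat : ℕ) : ℝ) = ((a 1 - 1 - b 1 : ℤ) : ℝ) by exact_mod_cast Int.toNat_of_nonneg (by omega)]
    push_cast; ring
  have e2 : (u + (a 2 : ℝ)) + (((b 2 - 1 - a 2).toNat : ℕ) : ℝ) = u + ((b 2 - 1 : ℤ) : ℝ) := by
    rw [show (((b 2 - 1 - a 2).toNat : ℕ) : ℝ) = ((b 2 - 1 - a 2 : ℤ) : ℝ) by exact_mod_cast Int.toNat_of_nonneg (by omega)]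
    push_cast; ring
  have e3 : (u + (a 3 : ℝ)) + (((b 3 - 1 - a 3).toNat : ℕ) : ℝ) = u + ((b 3 - 1 : ℤ) : ℝ) := by
    rw [show (((b 3 - 1 - a 3).toNat : ℕ) : ℝ) = ((b 3 - 1 - a 3 : ℤ) : ℝ) by exact_mod_cast Int.toNat_of_nonneg (by omega)]
    push_cast; ring
  rw [e0] at k0; rw [e1] at k1; rw [e2] at k2; rw [e3] at k3
  linarith

end Summit.KontsevichZagierPeriods.Zeta5Search.TwoTaleLineBound

end
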